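import Summits.CriticalPhenomena.PercolationContinuityZ3.Theorems.Transplant.FKConnectivityAllQAntipodalDictionary
import Summits.CriticalPhenomena.PercolationContinuityZ3.Theorems.Transplant.FKConnectivityAllQAntipodalFKG
import HarnessLib

/-!
# Connectivity correlation inequalities for `φ_{w,q}` — CONJECTURE T HOLDS FOR EVERY `q ≥ 1` ON EVERY GRAPH AND EVERY MINOR (FKG)

Proof file (`--supports stmt-CriticalPhenomena-4575`), census lineage (gen 38) of LANE 2's FK sub-programme; builds on p205010
(kernel theorem, internal audit signed; external expert review pending).  No definitions, no named facts, no sorries.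

fk-2 g12's `…AntipodalFKG.lean` showed that the antipodal weight `γ ↦ q^{k(γ)+k(E∖γ)}` is an FKG weight for `q ≥ 1` (no contracted
set).  Here the same is done WITH A CONTRACTED SET `C` — the weight `γ ↦ q^{k(γ∪C)+k((E∖γ)∪C)}` of the minor "keep `E`, contract `C`"
(`FK.apExpC`) is supermodular in `γ` (the cluster count is, Grimmett 2006 (3.12), the tree's `clusterCount_supermodular`), hence
satisfies the FKG lattice condition for `q ≥ 1` and Mathlib's `fkg` applies — and the consequence is read through census gen 25's
dictionary `FK.antipodalT_eq_two_mul_apUpcC`: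
* `FK.apExpC_supermodular`, `FK.apC_lattice_condition`, `FK.apC_fkg_of_one_le` — lattice condition and FKG for the minor weight;
* `FK.apUpcC_nonneg_of_one_le` — the antipodal up-correlation functional with contracted set is `≥ 0` for `q ≥ 1` on EVERY finite
  edge set (for every `q > 0` it is fk-2's Theorem U, but only on two-terminal series–parallel networks: `apUpcC_nonneg_of_isTTSP`);
* **`FK.antipodalT_nonneg_of_one_le`**, **`FK.antipodalTOn_of_one_le`**, **`FK.antipodalTFK_of_one_le`** — `T_q(z,s,t;F,ρ) ≥ 0` for
  every `q ≥ 1`, all vertices, all `F, ρ`: **the `q ≥ 1` half of CONJECTURE T** (`FK.AntipodalTPos`, census gen 25; the polar /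
  square-free-coefficient form, which is STRONGER than the measure-level FKG statement `FK.pairApexFK_of_one_le` it implies through
  `FK.pairApexFK_of_antipodalTFK`).  The content of the conjecture is `0 < q < 1`, where it is a THEOREM on series–parallel
  supports (`FK.antipodalT_nonneg_of_isTTSP`, census g37's `…_of_isTTSP_minor`) and census-verified on every graph with ≤ 10 vertices.
[cite: FortuinKasteleynGinibre1971, Thm. (Prop. 1)] [cite: Grimmett2006, Thm. 3.8, eqs. (3.11)–(3.12) (p. 40); §1.4 eq. (1.20) (p. 15)]
[cite: AyyerLinussonRavichandran2025, §7 eq. (13)–(15), Conj. 7.1 (p. 22)]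
-/

noncomputable section

namespace Summit.CriticalPhenomena.PercolationContinuityZ3.Theorems

namespace FK

open SimpleGraph Literature.Probability.LatticeModels Literature.Probability.Percolation
open scoped Classical

variable {V : Type*}

/-! ### Supermodularity of the minor exponent and the lattice condition -/

section Lattice

variable [Fintype V]

/-- **The minor exponent `k(γ ∪ C) + k((E ∖ γ) ∪ C)` is supermodular in `γ`**:
`apExpC E C a + apExpC E C b ≤ apExpC E C (a ∩ b) + apExpC E C (a ∪ b)` — supermodularity of the cluster count (Grimmett 2006, (3.12))
applied to `(a ∪ C, b ∪ C)` and to `((E∖a) ∪ C, (E∖b) ∪ C)`. [cite: Grimmett2006, Thm. 3.8, eq. (3.12) (p. 40)] -/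
theorem apExpC_supermodular (E C a b : Finset (Sym2 V)) :
    apExpC E C a + apExpC E C b ≤ apExpC E C (a ∩ b) + apExpC E C (a ∪ b) := by
  unfold apExpC
  have h₁ := clusterCount_supermodular (↑(a ∪ C) : BondConfig V) (↑(b ∪ C) : BondConfig V) (∅ : Set V)
  have h₂ := clusterCount_supermodular (↑(E \ a ∪ C) : BondConfig V) (↑(E \ b ∪ C) : BondConfig V) (∅ : Set V)
  have e₁ : ((↑(a ∪ C) : Set (Sym2 V)) ∩ ↑(b ∪ C)) = ↑(a ∩ b ∪ C) := by
    rw [← Finset.coe_inter]; congr 1; ext x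
    simp only [Finset.mem_inter, Finset.mem_union]; tauto
  have e₂ : ((↑(a ∪ C) : Set (Sym2 V)) ∪ ↑(b ∪ C)) = ↑(a ∪ b ∪ C) := by
    rw [← Finset.coe_union]; congr 1; ext x
    simp only [Finset.mem_union]; tauto
  have e₃ : ((↑(E \ a ∪ C) : Set (Sym2 V)) ∩ ↑(E \ b ∪ C)) = ↑(E \ (a ∪ b) ∪ C) := by
    rw [← Finset.coe_inter]; congr 1; ext x
    simp only [Finset.mem_inter, Finset.mem_sdiff, Finset.mem_union]; tauto
  have e₄ : ((↑(E \ a ∪ C) : Set (Sym2 V)) ∪ ↑(E \ b ∪ C)) = ↑(E \ (a ∩ b) ∪ C) := by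
    rw [← Finset.coe_union]; congr 1; ext x
    simp only [Finset.mem_inter, Finset.mem_sdiff, Finset.mem_union]; tauto
  rw [e₁, e₂] at h₁
  rw [e₃, e₄] at h₂
  omega

/-- **FKG lattice condition for the minor weight (`q ≥ 1`)**: with `w(γ) = q^{k(γ∪C)+k((E∖γ)∪C)}` for `γ ⊆ E` and `w = 0` otherwise,
`w(a) w(b) ≤ w(a ⊓ b) w(a ⊔ b)`. [cite: Grimmett2006, Thm. 3.8, eq. (3.11) (p. 40)] [cite: FortuinKasteleynGinibre1971, Thm. (Prop. 1)] -/
theorem apC_lattice_condition {q : ℝ} (hq : 1 ≤ q) (E C : Finset (Sym2 V)) (a b : Finset (Sym2 V)) :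
    (if a ⊆ E then q ^ apExpC E C a else 0) * (if b ⊆ E then q ^ apExpC E C b else 0) ≤
      (if a ⊓ b ⊆ E then q ^ apExpC E C (a ⊓ b) else 0) * (if a ⊔ b ⊆ E then q ^ apExpC E C (a ⊔ b) else 0) := by
  have hq0 : 0 ≤ q := zero_le_one.trans hq
  by_cases ha : a ⊆ E
  swap
  · rw [if_neg ha, zero_mul]
    exact mul_nonneg (by split_ifs <;> positivity) (by split_ifs <;> positivity)
  by_cases hb : b ⊆ E
  swap
  · rw [if_neg hb, mul_zero]
    exact mul_nonneg (by split_ifs <;> positivity) (by split_ifs <;> positivity)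
  have hab : a ⊓ b ⊆ E := fun x hx => ha (Finset.mem_inter.1 hx).1
  have hab' : a ⊔ b ⊆ E := Finset.union_subset ha hb
  rw [if_pos ha, if_pos hb, if_pos hab, if_pos hab', ← pow_add, ← pow_add]
  exact pow_le_pow_right₀ hq (apExpC_supermodular E C a b)

/-- **FKG inequality for the minor weight, `q ≥ 1`, on every finite edge set and every contracted set**: for nonnegative monotone
`f, g` on the edge sets, `(∑_{γ⊆E} w f)(∑_{γ⊆E} w g) ≤ (∑_{γ⊆E} w)(∑_{γ⊆E} w f g)` with `w = q^{k(γ∪C)+k((E∖γ)∪C)}`.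
[cite: FortuinKasteleynGinibre1971, Thm. (Prop. 1)] [cite: Grimmett2006, Thm. 3.8 (p. 40)] -/
theorem apC_fkg_of_one_le {q : ℝ} (hq : 1 ≤ q) (E C : Finset (Sym2 V)) {f g : Finset (Sym2 V) → ℝ}
    (hf0 : ∀ γ, 0 ≤ f γ) (hg0 : ∀ γ, 0 ≤ g γ) (hf : Monotone f) (hg : Monotone g) :
    (∑ γ ∈ E.powerset, q ^ apExpC E C γ * f γ) * (∑ γ ∈ E.powerset, q ^ apExpC E C γ * g γ) ≤
      (∑ γ ∈ E.powerset, q ^ apExpC E C γ) * (∑ γ ∈ E.powerset, q ^ apExpC E C γ * (f γ * g γ)) := by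
  have hq0 : 0 ≤ q := zero_le_one.trans hq
  set μ : Finset (Sym2 V) → ℝ := fun γ => if γ ⊆ E then q ^ apExpC E C γ else 0 with hμ
  have hμ0 : 0 ≤ μ := fun γ => by simp only [hμ, Pi.zero_apply]; split_ifs <;> positivity
  have hlat : ∀ a b, μ a * μ b ≤ μ (a ⊓ b) * μ (a ⊔ b) := fun a b => by
    simp only [hμ]; exact apC_lattice_condition hq E C a b
  have key := fkg (μ := μ) (f := f) (g := g) hμ0 (fun γ => hf0 γ) (fun γ => hg0 γ) hf hg hlat
  have r : ∀ φ : Finset (Sym2 V) → ℝ, ∑ γ, μ γ * φ γ = ∑ γ ∈ E.powerset, q ^ apExpC E C γ * φ γ := by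
    intro φ
    rw [← sum_ite_subset_eq_sum_powerset E (fun γ => q ^ apExpC E C γ * φ γ)]
    refine Finset.sum_congr rfl fun γ _ => ?_
    simp only [hμ]; split_ifs <;> simp
  have r0 : ∑ γ, μ γ = ∑ γ ∈ E.powerset, q ^ apExpC E C γ := by
    simpa using r (fun _ => 1)
  rw [r f, r g, r0, r (fun γ => f γ * g γ)] at key
  exact key

end Lattice

/-! ### Consequences for `q ≥ 1`: the up-correlation functional with contracted set and CONJECTURE T -/

section Consequences

variable [Fintype V]

omit [Fintype V] in
/-- The total minor weight of `E` is positive (`q > 0`). [folklore] -/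
theorem sum_apWeightC_pos {q : ℝ} (hq : 0 < q) (E C : Finset (Sym2 V)) : 0 < ∑ γ ∈ E.powerset, q ^ apExpC E C γ :=
  Finset.sum_pos (fun _ _ => pow_pos hq _) ⟨∅, Finset.mem_powerset.2 (Finset.empty_subset E)⟩

omit [Fintype V] in
/-- The signed sum `∑_{γ⊆E} q^{k+k̄} (c(γ∪C) - c((E∖γ)∪C)) = 0` (the summand is odd under `γ ↦ E ∖ γ`). [folklore] -/
theorem sum_apSignC_eq_zero (q : ℝ) (E C : Finset (Sym2 V)) (s t : V) :
    ∑ γ ∈ E.powerset, q ^ apExpC E C γ * (apConn (γ ∪ C) s t - apConn (E \ γ ∪ C) s t) = 0 := by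
  have h := sum_apSignC_compl q E C s t (fun _ => (1 : ℝ))
  have e : apUpcC q E C s t (fun _ => (1 : ℝ)) =
      ∑ γ ∈ E.powerset, q ^ apExpC E C γ * (apConn (γ ∪ C) s t - apConn (E \ γ ∪ C) s t) := by
    unfold apUpcC; refine Finset.sum_congr rfl fun γ _ => by ring
  simp only [mul_one] at h
  rw [e] at h
  linarith

/-- **The antipodal up-correlation functional WITH CONTRACTED SET is nonnegative for `q ≥ 1` on EVERY finite edge set**:
`0 ≤ apUpcC q E C s t h = ∑_{γ⊆E} q^{k(γ∪C)+k((E∖γ)∪C)} (1{s↔t in γ∪C} - 1{s↔t in (E∖γ)∪C}) h(γ)` for every `h` monotone on the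
subsets of `E`.  FKG for the minor weight applied to `γ ↦ c((γ∩E)∪C) - c((E∖γ)∪C) + 1` (antipodal mean `1`) and `γ ↦ h(γ∩E) - h(∅)`.
(For `0 < q < 1` this fails on `K₄`; on series–parallel networks it holds for every `q > 0`, fk-2's `apUpcC_nonneg_of_isTTSP`.)
[cite: FortuinKasteleynGinibre1971, Thm. (Prop. 1)] [cite: Grimmett2006, Thm. 3.8 (p. 40); §3.8 (pp. 61–62)] -/
theorem apUpcC_nonneg_of_one_le {q : ℝ} (hq : 1 ≤ q) (E C : Finset (Sym2 V)) (s t : V) {h : Finset (Sym2 V) → ℝ}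
    (hmono : ∀ ⦃A B : Finset (Sym2 V)⦄, A ⊆ B → B ⊆ E → h A ≤ h B) : 0 ≤ apUpcC q E C s t h := by
  have hq0 : 0 < q := zero_lt_one.trans_le hq
  set f : Finset (Sym2 V) → ℝ := fun γ => apConn (γ ∩ E ∪ C) s t - apConn (E \ γ ∪ C) s t + 1 with hf
  set g : Finset (Sym2 V) → ℝ := fun γ => h (γ ∩ E) - h ∅ with hg
  have hf0 : ∀ γ, 0 ≤ f γ := fun γ => by
    simp only [hf]; linarith [apConn_nonneg (γ ∩ E ∪ C) s t, apConn_le_one (E \ γ ∪ C) s t]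
  have hg0 : ∀ γ, 0 ≤ g γ := fun γ => by
    simp only [hg]; linarith [hmono (Finset.empty_subset (γ ∩ E)) Finset.inter_subset_right]
  have hfm : Monotone f := fun γ δ hγδ => by
    simp only [hf]
    have h1 := apConn_mono (Finset.union_subset_union (Finset.inter_subset_inter_right hγδ : γ ∩ E ⊆ δ ∩ E) (le_refl C)) s t
    have h2 := apConn_mono (Finset.union_subset_union (Finset.sdiff_subset_sdiff (subset_refl E) hγδ : E \ δ ⊆ E \ γ) (le_refl C)) s t
    linarith
  have hgm : Monotone g := fun γ δ hγδ => by
    simp only [hg]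
    linarith [hmono (Finset.inter_subset_inter_right hγδ : γ ∩ E ⊆ δ ∩ E) Finset.inter_subset_right]
  have key := apC_fkg_of_one_le hq E C hf0 hg0 hfm hgm
  set Z := ∑ γ ∈ E.powerset, q ^ apExpC E C γ with hZ
  have hZpos : 0 < Z := sum_apWeightC_pos hq0 E C
  have ef : ∀ γ ∈ E.powerset, f γ = (apConn (γ ∪ C) s t - apConn (E \ γ ∪ C) s t) + 1 := fun γ hγ => by
    simp only [hf, Finset.inter_eq_left.2 (Finset.mem_powerset.1 hγ)]
  have eg : ∀ γ ∈ E.powerset, g γ = h γ - h ∅ := fun γ hγ => by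
    simp only [hg, Finset.inter_eq_left.2 (Finset.mem_powerset.1 hγ)]
  have Sf : ∑ γ ∈ E.powerset, q ^ apExpC E C γ * f γ = Z := by
    calc ∑ γ ∈ E.powerset, q ^ apExpC E C γ * f γ
        = ∑ γ ∈ E.powerset, (q ^ apExpC E C γ * (apConn (γ ∪ C) s t - apConn (E \ γ ∪ C) s t) + q ^ apExpC E C γ) :=
          Finset.sum_congr rfl fun γ hγ => by rw [ef γ hγ]; ring
      _ = Z := by rw [Finset.sum_add_distrib, sum_apSignC_eq_zero, zero_add]
  have Sg : ∑ γ ∈ E.powerset, q ^ apExpC E C γ * g γ = (∑ γ ∈ E.powerset, q ^ apExpC E C γ * h γ) - h ∅ * Z := by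
    calc ∑ γ ∈ E.powerset, q ^ apExpC E C γ * g γ
        = ∑ γ ∈ E.powerset, (q ^ apExpC E C γ * h γ - h ∅ * q ^ apExpC E C γ) :=
          Finset.sum_congr rfl fun γ hγ => by rw [eg γ hγ]; ring
      _ = _ := by rw [Finset.sum_sub_distrib, ← Finset.mul_sum]
  have Sfg : ∑ γ ∈ E.powerset, q ^ apExpC E C γ * (f γ * g γ) =
      apUpcC q E C s t h + (∑ γ ∈ E.powerset, q ^ apExpC E C γ * h γ) - h ∅ * Z := by
    have e1 : ∑ γ ∈ E.powerset, q ^ apExpC E C γ * (f γ * g γ) =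
        ∑ γ ∈ E.powerset, (q ^ apExpC E C γ * ((apConn (γ ∪ C) s t - apConn (E \ γ ∪ C) s t) * h γ)
          - h ∅ * (q ^ apExpC E C γ * (apConn (γ ∪ C) s t - apConn (E \ γ ∪ C) s t))
          + (q ^ apExpC E C γ * h γ - h ∅ * q ^ apExpC E C γ)) :=
      Finset.sum_congr rfl fun γ hγ => by rw [ef γ hγ, eg γ hγ]; ring
    rw [e1, Finset.sum_add_distrib, Finset.sum_sub_distrib, Finset.sum_sub_distrib, ← Finset.mul_sum, ← Finset.mul_sum,
      sum_apSignC_eq_zero, mul_zero, sub_zero, ← hZ]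
    unfold apUpcC; ring
  rw [Sf, Sg, Sfg] at key
  have : 0 ≤ Z * apUpcC q E C s t h := by nlinarith
  exact (mul_nonneg_iff_of_pos_left hZpos).1 this

/-- **CONJECTURE T FOR `q ≥ 1`, finitely supported form: `T_q(z,s,t;F,C) ≥ 0`** for every `q ≥ 1`, every finite edge set `F`,
every contracted set `C` and all vertices `z, s, t` — the dictionary `FK.antipodalT_eq_two_mul_apUpcC` and `apUpcC_nonneg_of_one_le`
with the monotone attachment indicator.  No series–parallel hypothesis. [cite: AyyerLinussonRavichandran2025, §7 eq. (13)–(15) (p. 22)]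
[cite: FortuinKasteleynGinibre1971, Thm. (Prop. 1)] -/
theorem antipodalT_nonneg_of_one_le {q : ℝ} (hq : 1 ≤ q) (F C : Finset (Sym2 V)) (z s t : V) :
    0 ≤ antipodalT q z s t (↑F : BondConfig V) (↑C : BondConfig V) := by
  rw [antipodalT_eq_two_mul_apUpcC]
  refine mul_nonneg (by norm_num) ?_
  refine apUpcC_nonneg_of_one_le hq F C s t (h := fun γ => apAttach (γ ∪ C) z s t) ?_
  intro A B hAB _
  exact apAttach_mono (Finset.union_subset_union hAB (le_refl C)) z s t

/-- **CONJECTURE T FOR `q ≥ 1` on the vertex type `V`** (`FK.AntipodalTOn V q`): `T_q(z,s,t;F,ρ) ≥ 0` for all vertices and all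
`F, ρ` (the disjointness hypothesis of `AntipodalTOn` is not even needed). [cite: AyyerLinussonRavichandran2025, §7 (p. 22)] -/
theorem antipodalTOn_of_one_le {q : ℝ} (hq : 1 ≤ q) : AntipodalTOn V q := by
  intro z s t F ρ _
  have hF : (↑(Set.toFinset F) : BondConfig V) = F := Set.coe_toFinset F
  have hρ : (↑(Set.toFinset ρ) : BondConfig V) = ρ := Set.coe_toFinset ρ
  rw [← hF, ← hρ]
  exact antipodalT_nonneg_of_one_le hq _ _ z s t

end Consequences

/-- **THE `q ≥ 1` HALF OF CONJECTURE T** (census gen 25's `FK.AntipodalTPos`, the polar reduction of the hub conjecture): for every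
`q ≥ 1` and every `n`, `FK.AntipodalTOn (Fin n) q` — antipodal nonnegativity on every minor of every finite graph, by FKG for the minor
weight.  (Through `FK.pairApexFK_of_antipodalTFK` this re-proves the measure-level `FK.pairApexFK_of_one_le`; the content of the
conjecture is `0 < q < 1`.) [cite: FortuinKasteleynGinibre1971, Thm. (Prop. 1)] [cite: AyyerLinussonRavichandran2025, §7 eq. (13)–(15), Conj. 7.1 (p. 22)] -/
theorem antipodalTFK_of_one_le {q : ℝ} (hq : 1 ≤ q) : AntipodalTFK q :=
  fun _ => antipodalTOn_of_one_le hq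

/-- **What remains of CONJECTURE T**: `FK.AntipodalTPos` holds as soon as `AntipodalTFK q` holds for every `0 < q < 1` — the `q ≥ 1` range is
`antipodalTFK_of_one_le`.  (Statement about the @[conjecture] node; nothing is claimed for `q < 1` beyond the series–parallel class.)
[cite: AyyerLinussonRavichandran2025, §7 eq. (13)–(15), Conj. 7.1 (p. 22)] -/
theorem antipodalTPos_of_lt_one (h : ∀ q : ℝ, 0 < q → q < 1 → AntipodalTFK q) : AntipodalTPos := by
  intro q hq
  by_cases hq1 : q < 1
  · exact h q hq hq1
  · exact antipodalTFK_of_one_le (not_lt.1 hq1)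

/-- `FK.AntipodalTPos` is EQUIVALENT to its restriction to `0 < q < 1`. [cite: AyyerLinussonRavichandran2025, §7 (p. 22)] -/
theorem antipodalTPos_iff_lt_one : AntipodalTPos ↔ ∀ q : ℝ, 0 < q → q < 1 → AntipodalTFK q :=
  ⟨fun h q hq _ => h q hq, antipodalTPos_of_lt_one⟩

end FK

end Summit.CriticalPhenomena.PercolationContinuityZ3.Theorems

end
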